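import Literature.NumberTheory.Weil1964.AdelicMetaplecticOfArchImplementer
import Literature.NumberTheory.Weil1964.ArchSectionThetaMajorants
import Literature.NumberTheory.Weil1964.ArchMetaplecticExtension
import HarnessLib

/-!
# The archimedean lift `G →* Mp_ψ(W_𝔸)ᶜᵒⁿᵗ` of a metaplectic section `s : G →* Mp^𝓢(W_∞)` read in a Folland frame

Topic `NumberTheory/Weil1964`; namespace `Literature.NumberTheory.Weil1964`.  KERNEL MATHEMATICS ONLY: two explicit
definitions with body (`carrierConjEquiv`, `archLift`) and proved theorems; no `def … : Prop` record, no axiom, no proof hole.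

Continuation of `AdelicMetaplecticOfArchImplementer` (`archElt`: an archimedean `g ∈ Sp(W_𝔸)` fixing the finite vectors
and a Weil-covariant archimedean operator `A` give the element `(g, A ⊗ 1)` of `Mp_ψ(W_𝔸)ᶜᵒⁿᵗ`).  Given

* a homomorphism `j : G →* Sp(W_𝔸)` whose values fix the finite vectors (archimedean elements), and
* a homomorphism `s : G →* Mp^𝓢(ℝ^σ)` into the metaplectic group of the Schwartz model (`ArchMetaplecticExtension.MpS`)
  whose phase-space action is THE DICTIONARY of `j`: `archPhaseMap T e (j g) = ⇑(proj (s g))` in a Folland frame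
  `e : X_∞ ≃L ℝ^σ` (`ArchFollandCoordinates.archPhaseMap`),

this file constructs the homomorphism **`archLift : G →* Mp_ψ(W_𝔸)ᶜᵒⁿᵗ`**, `g ↦ (j g, (e^* ∘ s(g) ∘ e_*) ⊗ 1)` and proves:
`proj ∘ archLift = j` (`proj_archLift`, `rfl`), `ω(archLift g) = carrierConj e (s g) ⊗ 1` is ARCHIMEDEAN (`omega_archLift`,
`isArch_archLift`), and `archLift` is CONTINUOUS for the coefficient topology of `Mp_ψ(W_𝔸)ᶜᵒⁿᵗ` as soon as the `π`-orbit maps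
of `j` and the `𝓢`-orbit maps of `s` are (`continuous_archLift`) — the matrix coefficient `(ω(archLift g)Φ)(x)` on
`Φ = Φ_∞ ⊗ Φ_f` is `(e^* s(g) e_* Φ_∞)(x_∞) · Φ_f(x_f)`.

This is the generic shape of the ARCHIMEDEAN HALF `s_∞ : H(F ⊗ ℝ) → Mp(W_𝐀)` of a global splitting
[GelbartRogawski1991, §3.1 p. 454; Weil1964, Chap. III n° 37–39]: `G = U(J)(F ⊗ ℝ)`, `j = ι_𝔸 ∘ (g ↦ (g, 1))`, `s` the
archimedean metaplectic section in the scaled Folland frame.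

## References

* [Weil1964] A. Weil, Acta Math. 111 (1964), Chap. III n° 37–39 pp. 188–190.
* [GelbartRogawski1991] S. Gelbart, J. Rogawski, Invent. math. 105 (1991), §3.1 p. 454.
* [MoeglinVignerasWaldspurger1987] C. Mœglin, M.-F. Vignéras, J.-L. Waldspurger, LNM 1291 (1987), Chap. 2 II.1.
* [Folland1989] G. B. Folland, *Harmonic Analysis in Phase Space*, Princeton UP 1989, §4.2 (4.23).
-/

set_option autoImplicit false

noncomputable section

open MeasureTheory Complex SchwartzMap
open scoped TensorProduct Classical
open NumberField NumberField.mixedEmbedding IsDedekindDomain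

namespace Literature.NumberTheory.Weil1964

open Literature.Analysis.SegalBargmann Literature.RepresentationTheory.HeisenbergGroup
open Literature.NumberTheory.Automorphic

local notation "SR" σ => SchwartzMap (σ → ℝ) ℂ
local notation "SD" D => SchwartzMap D ℂ

/-! ## §1 Conjugating a topological automorphism of `𝓢(ℝ^σ)` by a frame -/

section Carrier

variable {σ : Type*} [Fintype σ] {D : Type*} [NormedAddCommGroup D] [NormedSpace ℝ D]

/-- **`carrierConjEquiv e S = e^* ∘ S ∘ e_*`** as a topological automorphism of `𝓢(D)` (the `≃L` form of
`ArchSectionThetaMajorants.carrierConj`). [cite: Folland1989, §4.2 (4.23)] -/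
def carrierConjEquiv (e : D ≃L[ℝ] (σ → ℝ)) (S : (SR σ) ≃L[ℂ] SR σ) : (SD D) ≃L[ℂ] SD D :=
  ((schwartzTransport e).trans S).trans (schwartzTransport e).symm

/-- Unfolding. [cite: Folland1989, §4.2 (4.23)] -/
@[simp] theorem carrierConjEquiv_apply (e : D ≃L[ℝ] (σ → ℝ)) (S : (SR σ) ≃L[ℂ] SR σ) (Φ : SD D) :
    carrierConjEquiv e S Φ = (schwartzTransport e).symm (S (schwartzTransport e Φ)) := rfl

/-- as a continuous linear map it is `carrierConj e S`. [cite: Folland1989, §4.2 (4.23)] -/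
theorem coe_carrierConjEquiv (e : D ≃L[ℝ] (σ → ℝ)) (S : (SR σ) ≃L[ℂ] SR σ) :
    (carrierConjEquiv e S : (SD D) →L[ℂ] SD D) = carrierConj e (S : (SR σ) →L[ℂ] SR σ) :=
  ContinuousLinearMap.ext fun _ => rfl

/-- `carrierConjEquiv e` is multiplicative. [cite: Folland1989, §4.2 (4.23)] -/
theorem carrierConjEquiv_mul (e : D ≃L[ℝ] (σ → ℝ)) (S S' : (SR σ) ≃L[ℂ] SR σ) :
    carrierConjEquiv e (S * S') = carrierConjEquiv e S * carrierConjEquiv e S' := by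
  refine ContinuousLinearEquiv.ext (funext fun Φ => ?_)
  show (schwartzTransport e).symm (S (S' (schwartzTransport e Φ))) =
    (schwartzTransport e).symm (S (schwartzTransport e ((schwartzTransport e).symm (S' (schwartzTransport e Φ)))))
  rw [ContinuousLinearEquiv.apply_symm_apply]

/-- `carrierConjEquiv e 1 = 1`. [cite: Folland1989, §4.2 (4.23)] -/
theorem carrierConjEquiv_one (e : D ≃L[ℝ] (σ → ℝ)) : carrierConjEquiv e (1 : (SR σ) ≃L[ℂ] SR σ) = 1 := by
  refine ContinuousLinearEquiv.ext (funext fun Φ => ?_)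
  show (schwartzTransport e).symm (schwartzTransport e Φ) = Φ
  rw [ContinuousLinearEquiv.symm_apply_apply]

end Carrier

/-! ## §2 `A ⊗ 1` is multiplicative in `A` -/

section TensorEnd

variable {F : Type} [Field F] [NumberField F] {ι : Type} [Fintype ι]

/-- `(A B) ⊗ 1 = (A ⊗ 1)(B ⊗ 1)`. [cite: Weil1964, Chap. III n° 38 p. 189] -/
theorem tensorEndEquiv_mul (A B : 𝓢((ι → mixedSpace F), ℂ) ≃L[ℂ] 𝓢((ι → mixedSpace F), ℂ)) :
    tensorEndEquiv (A * B) = tensorEndEquiv A * tensorEndEquiv B := by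
  refine LinearEquiv.ext fun Ψ => ?_
  obtain ⟨z, rfl⟩ := (piSchwartzBruhatEquiv F ι).surjective Ψ
  show tensorEndEquiv (A * B) (piSchwartzBruhatEquiv F ι z) =
    tensorEndEquiv A (tensorEndEquiv B (piSchwartzBruhatEquiv F ι z))
  induction z using TensorProduct.induction_on with
  | zero => simp only [map_zero]
  | tmul Φ f => rw [tensorEndEquiv_tmul, tensorEndEquiv_tmul, tensorEndEquiv_tmul]; rfl
  | add z₁ z₂ h₁ h₂ => simp only [map_add, h₁, h₂]

/-- `1 ⊗ 1 = 1`. [cite: Weil1964, Chap. III n° 38 p. 189] -/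
theorem tensorEndEquiv_one :
    tensorEndEquiv (1 : 𝓢((ι → mixedSpace F), ℂ) ≃L[ℂ] 𝓢((ι → mixedSpace F), ℂ)) = 1 := by
  refine LinearEquiv.ext fun Ψ => ?_
  obtain ⟨z, rfl⟩ := (piSchwartzBruhatEquiv F ι).surjective Ψ
  show tensorEndEquiv 1 (piSchwartzBruhatEquiv F ι z) = piSchwartzBruhatEquiv F ι z
  induction z using TensorProduct.induction_on with
  | zero => simp only [map_zero]
  | tmul Φ f => rw [tensorEndEquiv_tmul]; rfl
  | add z₁ z₂ h₁ h₂ => simp only [map_add, h₁, h₂]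

end TensorEnd

/-! ## §3 The archimedean lift of a section read in a Folland frame -/

section Lift

variable {F : Type} [Field F] [NumberField F] {ι : Type} [Fintype ι] [DecidableEq ι]
  (T : Matrix ι ι (AdeleRing (𝓞 F) F)) {σ : Type*} [Fintype σ]
  (e : (ι → mixedSpace F) ≃L[ℝ] (σ → ℝ)) (hT' : IsUnit (archMat F ι T))
  {G : Type*} [Group G] (j : G →* symplecticGroup (polar (adelicForm F ι T))) (s : G →* MpS σ)
  (hj : ∀ (g : G) (k c : ι → FiniteAdeleRing (𝓞 F) F), (j g).1 (finVec k, finVec c) = (finVec k, finVec c))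
  (hdict : ∀ g : G, archPhaseMap T e hT' (j g) =
    ⇑((MpS.proj (s g)).1 : ((σ → ℝ) × (σ → ℝ)) ≃ₗ[ℝ] ((σ → ℝ) × (σ → ℝ))))

include hdict in
/-- **Weil covariance of `e^* s(g) e_*` over `j g`** (the hypothesis `hA` of `archElt`): from the Heisenberg covariance of
`s g ∈ Mp^𝓢(ℝ^σ)` over `proj (s g)`, the frame transport `carrierConj_rhoSD`, the dictionary `hdict` and the cocycle-one
lemma `arch_implements_of_covariant_rhoSD_clm`. [cite: Weil1964, Chap. III n° 38 p. 189; Folland1989, §4.2 (4.23)] -/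
theorem carrierConjEquiv_archModTrans (g : G) (a w : ι → mixedSpace F) (Φ : 𝓢((ι → mixedSpace F), ℂ)) :
    carrierConjEquiv e (s g).1.2 (archModTrans F ι T a w Φ) =
      weilPhase T (j g) (a, w) •
        archModTrans F ι T (archAct T (j g) (a, w)).1 (archAct T (j g) (a, w)).2 (carrierConjEquiv e (s g).1.2 Φ) := by
  have hcov : ∀ (p q : σ → ℝ) (f : SR σ), (s g).1.2 (rhoS p q f) =
      rhoS ((((MpS.proj (s g)).1 : ((σ → ℝ) × (σ → ℝ)) ≃ₗ[ℝ] ((σ → ℝ) × (σ → ℝ))) : PhaseMap σ) (p, q)).1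
        ((((MpS.proj (s g)).1 : ((σ → ℝ) × (σ → ℝ)) ≃ₗ[ℝ] ((σ → ℝ) × (σ → ℝ))) : PhaseMap σ) (p, q)).2 ((s g).1.2 f) :=
    ((MpS.mem_iff_covariant _).1 (s g).2).1
  have hA : ∀ (p q : σ → ℝ) (Ψ : 𝓢((ι → mixedSpace F), ℂ)),
      (carrierConjEquiv e (s g).1.2 : 𝓢((ι → mixedSpace F), ℂ) →L[ℂ] 𝓢((ι → mixedSpace F), ℂ)) (rhoSD e p q Ψ) =
        rhoSD e (archPhaseMap T e hT' (j g) (p, q)).1 (archPhaseMap T e hT' (j g) (p, q)).2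
          ((carrierConjEquiv e (s g).1.2 : 𝓢((ι → mixedSpace F), ℂ) →L[ℂ] 𝓢((ι → mixedSpace F), ℂ)) Ψ) := by
    intro p q Ψ
    rw [coe_carrierConjEquiv, hdict g]
    exact carrierConj_rhoSD e hcov p q Ψ
  exact arch_implements_of_covariant_rhoSD_clm T e hT' (j g) _ hA a w Φ

/-- two elements of `Mp_ψ(W_𝔸)ᶜᵒⁿᵗ` with the same underlying pair are equal. [cite: GelbartRogawski1991, §3.1 p. 454] -/
theorem adelicMpCont.eq_of_coe_coe_eq {x y : adelicMpCont F ι T}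
    (h : ((x : adelicMp F ι T) :
        symplecticGroup (polar (adelicForm F ι T)) × (piSchwartzBruhat F ι ≃ₗ[ℂ] piSchwartzBruhat F ι)) =
      ((y : adelicMp F ι T) :
        symplecticGroup (polar (adelicForm F ι T)) × (piSchwartzBruhat F ι ≃ₗ[ℂ] piSchwartzBruhat F ι))) :
    x = y :=
  Subtype.ext (Subtype.ext h)

/-- the underlying pair of a product. [cite: GelbartRogawski1991, §3.1 p. 454] -/
theorem adelicMpCont.coe_coe_mul (x y : adelicMpCont F ι T) :
    ((((x * y : adelicMpCont F ι T)) : adelicMp F ι T) :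
        symplecticGroup (polar (adelicForm F ι T)) × (piSchwartzBruhat F ι ≃ₗ[ℂ] piSchwartzBruhat F ι)) =
      ((x : adelicMp F ι T) :
          symplecticGroup (polar (adelicForm F ι T)) × (piSchwartzBruhat F ι ≃ₗ[ℂ] piSchwartzBruhat F ι)) *
        ((y : adelicMp F ι T) :
          symplecticGroup (polar (adelicForm F ι T)) × (piSchwartzBruhat F ι ≃ₗ[ℂ] piSchwartzBruhat F ι)) :=
  rfl

/-- the underlying pair of `1`. [cite: GelbartRogawski1991, §3.1 p. 454] -/
theorem adelicMpCont.coe_coe_one :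
    (((1 : adelicMpCont F ι T) : adelicMp F ι T) :
        symplecticGroup (polar (adelicForm F ι T)) × (piSchwartzBruhat F ι ≃ₗ[ℂ] piSchwartzBruhat F ι)) = 1 :=
  rfl

/-- the element `(j g, (e^* s(g) e_*) ⊗ 1)`. [cite: GelbartRogawski1991, §3.1 p. 454] -/
def archLiftElt (g : G) : adelicMpCont F ι T :=
  archElt T (carrierConjEquiv e (s g).1.2) (hj g) (carrierConjEquiv_archModTrans T e hT' j s hdict g)

/-- its underlying pair. [cite: GelbartRogawski1991, §3.1 p. 454] -/
theorem coe_coe_archLiftElt (g : G) :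
    ((archLiftElt T e hT' j s hj hdict g : adelicMp F ι T) :
        symplecticGroup (polar (adelicForm F ι T)) × (piSchwartzBruhat F ι ≃ₗ[ℂ] piSchwartzBruhat F ι)) =
      (j g, tensorEndEquiv (carrierConjEquiv e (s g).1.2)) := rfl

/-- the operator component of `x : Mp^𝓢` is multiplicative. [cite: Folland1989, §4.2 (4.23)] -/
theorem MpS.coe_snd_mul {σ : Type*} [Fintype σ] (x y : MpS σ) : (x * y).1.2 = x.1.2 * y.1.2 := rfl

/-- the operator component of `1 : Mp^𝓢` is `1`. [cite: Folland1989, §4.2 (4.23)] -/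
theorem MpS.coe_snd_one {σ : Type*} [Fintype σ] : (1 : MpS σ).1.2 = 1 := rfl

/-- `archLiftElt 1 = 1`. [cite: GelbartRogawski1991, §3.1 p. 454] -/
theorem archLiftElt_one : archLiftElt T e hT' j s hj hdict 1 = 1 := by
  have h1 : s 1 = 1 := map_one s
  have h2 : j 1 = 1 := map_one j
  refine adelicMpCont.eq_of_coe_coe_eq T ?_
  rw [coe_coe_archLiftElt, adelicMpCont.coe_coe_one, h1, h2, MpS.coe_snd_one, carrierConjEquiv_one, tensorEndEquiv_one]
  rfl

/-- `archLiftElt (g h) = archLiftElt g · archLiftElt h`. [cite: GelbartRogawski1991, §3.1 p. 454] -/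
theorem archLiftElt_mul (g h : G) :
    archLiftElt T e hT' j s hj hdict (g * h) = archLiftElt T e hT' j s hj hdict g * archLiftElt T e hT' j s hj hdict h := by
  have h1 : s (g * h) = s g * s h := map_mul s g h
  have h2 : j (g * h) = j g * j h := map_mul j g h
  refine adelicMpCont.eq_of_coe_coe_eq T ?_
  rw [adelicMpCont.coe_coe_mul, coe_coe_archLiftElt, coe_coe_archLiftElt, coe_coe_archLiftElt, h1, h2, MpS.coe_snd_mul,
    carrierConjEquiv_mul, tensorEndEquiv_mul, Prod.mk_mul_mk]

/-- **`archLift : G →* Mp_ψ(W_𝔸)ᶜᵒⁿᵗ`**, `g ↦ (j g, (e^* s(g) e_*) ⊗ 1)` — the archimedean lift of the section `s` read in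
the frame `e`. [cite: GelbartRogawski1991, §3.1 p. 454; Weil1964, Chap. III n° 37–38] -/
def archLift : G →* adelicMpCont F ι T where
  toFun := archLiftElt T e hT' j s hj hdict
  map_one' := archLiftElt_one T e hT' j s hj hdict
  map_mul' := archLiftElt_mul T e hT' j s hj hdict

/-- Unfolding. [cite: GelbartRogawski1991, §3.1 p. 454] -/
theorem archLift_apply (g : G) : archLift T e hT' j s hj hdict g = archLiftElt T e hT' j s hj hdict g := rfl

/-- **`proj (archLift g) = j g`.** [cite: GelbartRogawski1991, §3.1 p. 454] -/
@[simp] theorem proj_archLift (g : G) : adelicMpCont.proj F ι T (archLift T e hT' j s hj hdict g) = j g := rfl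

/-- as homomorphisms: `proj ∘ archLift = j`. [cite: GelbartRogawski1991, §3.1 p. 454] -/
theorem proj_comp_archLift : (adelicMpCont.proj F ι T).comp (archLift T e hT' j s hj hdict) = j :=
  MonoidHom.ext fun _ => rfl

/-- **`ω(archLift g) = (e^* s(g) e_*) ⊗ 1`.** [cite: Weil1964, Chap. III n° 38 p. 189] -/
theorem omega_archLift (g : G) :
    (adelicMpCont.omega F ι T (archLift T e hT' j s hj hdict g) : piSchwartzBruhat F ι →ₗ[ℂ] piSchwartzBruhat F ι) =
      adelicTensorEnd ((carrierConjEquiv e (s g).1.2 : 𝓢((ι → mixedSpace F), ℂ) →L[ℂ] 𝓢((ι → mixedSpace F), ℂ)) :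
        𝓢((ι → mixedSpace F), ℂ) →ₗ[ℂ] 𝓢((ι → mixedSpace F), ℂ)) LinearMap.id :=
  rfl

/-- **`ω(archLift g)` is ARCHIMEDEAN**: `= A ⊗ 1` for a continuous `A` on `𝓢(X_∞)`. [cite: Weil1964, Chap. III n° 38 p. 189] -/
theorem isArch_archLift (g : G) :
    ∃ A : 𝓢((ι → mixedSpace F), ℂ) →L[ℂ] 𝓢((ι → mixedSpace F), ℂ),
      (adelicMpCont.omega F ι T (archLift T e hT' j s hj hdict g) :
          piSchwartzBruhat F ι →ₗ[ℂ] piSchwartzBruhat F ι) =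
        adelicTensorEnd (A : 𝓢((ι → mixedSpace F), ℂ) →ₗ[ℂ] 𝓢((ι → mixedSpace F), ℂ)) LinearMap.id :=
  ⟨_, omega_archLift T e hT' j s hj hdict g⟩

/-- on pure tensors: `ω(archLift g)(Φ_∞ ⊗ Φ_f) = (e^* s(g) e_* Φ_∞) ⊗ Φ_f`. [cite: Weil1964, Chap. III n° 38 p. 189] -/
theorem omega_archLift_tmul (g : G) (Φ : 𝓢((ι → mixedSpace F), ℂ)) (f : FinSB F ι) :
    adelicMpCont.omega F ι T (archLift T e hT' j s hj hdict g) (piSchwartzBruhatEquiv F ι (Φ ⊗ₜ f)) =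
      piSchwartzBruhatEquiv F ι (carrierConjEquiv e (s g).1.2 Φ ⊗ₜ f) :=
  tensorEndEquiv_tmul _ Φ f

/-- **Continuity of `archLift`** for the coefficient topology of `Mp_ψ(W_𝔸)ᶜᵒⁿᵗ`, from the continuity of the `π`-orbit maps
of `j` and of the `𝓢`-orbit maps of `s`. [cite: Weil1964, Chap. III n° 37–39 pp. 188–190] -/
theorem continuous_archLift [TopologicalSpace G]
    (hjw : ∀ w : (ι → AdeleRing (𝓞 F) F) × (ι → AdeleRing (𝓞 F) F), Continuous fun g : G =>
      ((j g).1 : ((ι → AdeleRing (𝓞 F) F) × (ι → AdeleRing (𝓞 F) F)) ≃ₗ[AdeleRing (𝓞 F) F]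
        ((ι → AdeleRing (𝓞 F) F) × (ι → AdeleRing (𝓞 F) F))) w)
    (hsc : ∀ f : SR σ, Continuous fun g : G => (s g).1.2 f) :
    Continuous (archLift T e hT' j s hj hdict) := by
  rw [continuous_into_adelicMpCont_iff, continuous_into_adelicMp_iff]
  refine ⟨fun w => hjw w, fun Ψ x => ?_⟩
  have hA : ∀ Φ : 𝓢((ι → mixedSpace F), ℂ), Continuous fun g : G => carrierConjEquiv e (s g).1.2 Φ := fun Φ => by
    simp only [carrierConjEquiv_apply]
    exact (schwartzTransport e).symm.continuous.comp (hsc (schwartzTransport e Φ))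
  suffices h : ∀ t, Continuous fun g : G =>
      ((adelicMpCont.omega F ι T (archLift T e hT' j s hj hdict g) (piSchwartzBruhatEquiv F ι t) :
        piSchwartzBruhat F ι) : (ι → AdeleRing (𝓞 F) F) → ℂ) x by
    refine (h ((piSchwartzBruhatEquiv F ι).symm Ψ)).congr fun g => ?_
    exact congrArg (fun Θ : piSchwartzBruhat F ι =>
      ((adelicMpCont.omega F ι T (archLift T e hT' j s hj hdict g) Θ : piSchwartzBruhat F ι) :
        (ι → AdeleRing (𝓞 F) F) → ℂ) x) ((piSchwartzBruhatEquiv F ι).apply_symm_apply Ψ)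
  intro t
  induction t using TensorProduct.induction_on with
  | zero =>
    refine (continuous_const (y := (0 : ℂ))).congr fun g => ?_
    simp only [map_zero, ZeroMemClass.coe_zero, Pi.zero_apply]
  | tmul Φ f =>
    have hev : Continuous fun Θ : 𝓢((ι → mixedSpace F), ℂ) => Θ (piArch F ι x) :=
      ((BoundedContinuousFunction.evalCLM ℂ (piArch F ι x)).comp
        (SchwartzMap.toBoundedContinuousFunctionCLM ℂ (ι → mixedSpace F) ℂ)).continuous
    refine ((hev.comp (hA Φ)).mul (continuous_const
      (y := (f : (ι → FiniteAdeleRing (𝓞 F) F) → ℂ) (piFinite F ι x)))).congr fun g => ?_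
    show _ = ((adelicMpCont.omega F ι T (archLift T e hT' j s hj hdict g) (piSchwartzBruhatEquiv F ι (Φ ⊗ₜ f)) :
      piSchwartzBruhat F ι) : (ι → AdeleRing (𝓞 F) F) → ℂ) x
    rw [omega_archLift_tmul, coe_piSchwartzBruhatEquiv_tmul_apply]
    rfl
  | add t₁ t₂ h₁ h₂ =>
    refine (h₁.add h₂).congr fun g => ?_
    simp only [map_add, Submodule.coe_add, Pi.add_apply]

end Lift

end Literature.NumberTheory.Weil1964

end
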